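import Literature.AlgebraicGeometry.Resolution.SmoothOfRegularPerfectField
import Literature.AlgebraicGeometry.Resolution.SncSaturatedCentre
import Literature.AlgebraicGeometry.Morphisms.GenericFibreSmooth
import Mathlib.AlgebraicGeometry.FunctionField
import HarnessLib

/-!
# Generic smoothness of the strata of a simple normal crossings boundary over a base

Topic: `Literature/AlgebraicGeometry/Resolution`. Let `g : X → Y` be universally closed and
locally of finite presentation, `Y` integral with function field of characteristic zero, and let
`E` be a boundary with simple normal crossings on `X` (`HasSNC E`, BGMW Def. 3.1.1; in particular
`X` is regular). The strata `V(∑_{K ∈ T} K) = ⋂_{K ∈ T} V(K)` (`T` a finite set of members of `E`)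
are regular schemes (`HasSNC.isRegular_subscheme_finsetSup`, Matsumura Thm. 14.2), hence SMOOTH
over `Y` above a neighbourhood of the generic point (generic smoothness in characteristic zero,
Hartshorne III Cor. 10.7: a regular local ring essentially of finite type over a field of
characteristic zero is formally smooth over it, Matsumura §30 Remark 2 / Stacks 00TV, applied to
the stalks over the generic point, whose local ring on `Y` is the function field; then spread by
closedness of `g`). Everything is PROVED:

* `mem_smoothLocus_of_isRegularLocalRing_of_apply_eq_genericPoint` — a point with regular local
  ring lying over the generic point of `Y` is in the smooth locus of `g`;
* `exists_mem_and_forall_smooth_morphismRestrict` — for finitely many closed subschemes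
  `ι_t : V_t → X` all of whose local rings over the generic point are regular, there is ONE open
  `O ∋ η` of `Y` with every `(ι_t ≫ g)|_O` smooth;
* `HasSNC.exists_forall_smooth_strata` — for an snc boundary `E`: an open `O ∋ η` over which
  `g` and all the strata `V(∑_{K∈T} K) → Y`, `T ⊆ E`, are smooth.

## References

* R. Hartshorne, *Algebraic Geometry* (1977), III Cor. 10.7 (generic smoothness). [Hartshorne1977]
* H. Matsumura, *Commutative Ring Theory* (1986), Thm. 14.2; §30 Remark 2. [Matsumura1987]
* The Stacks Project, Tags 00TV, 01V9. [StacksProject]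
* E. Bierstone, D. Grigoriev, P. Milman, J. Włodarczyk, arXiv:1206.3090, Def. 3.1.1.
  [BierstoneGrigorievMilmanWlodarczyk2011]
-/

noncomputable section

open CategoryTheory CategoryTheory.Limits AlgebraicGeometry TopologicalSpace IsLocalRing
  Literature.AlgebraicGeometry.Morphisms

namespace Literature.AlgebraicGeometry.Resolution

universe u

variable {X Y : Scheme.{u}}

/-! ## Points with regular local ring over the generic point are smooth points -/

/-- **Regular over the generic point ⇒ smooth there.** Let `Y` be integral with function field
of characteristic zero, `g : X → Y` locally of finite presentation, and `x ∈ X` a point over the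
generic point of `Y` whose local ring is regular. Then `x` lies in the smooth locus of `g`: the
stalk map at `x` is a ring map, essentially of finite type, from the function field `K(Y)`
(a perfect field) to the regular local ring `𝒪_{X,x}`, hence formally smooth (Stacks 00TV, the
tree's `formallySmooth_of_isRegularLocalRing_of_perfectField`).
[cite: StacksProject, Tag 00TV] [cite: Matsumura1987, §30 Remark 2 after Thm. 30.3] -/
theorem mem_smoothLocus_of_isRegularLocalRing_of_apply_eq_genericPoint [IsIntegral Y]
    [CharZero Y.functionField] (g : X ⟶ Y) [LocallyOfFinitePresentation g] {x : X}
    (hx : g x = genericPoint Y) (hreg : IsRegularLocalRing (X.presheaf.stalk x)) :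
    x ∈ g.smoothLocus := by
  rw [Scheme.Hom.mem_smoothLocus]
  have hF : IsField (Y.presheaf.stalk (g x)) := by
    rw [hx]
    exact Field.toIsField Y.functionField
  have hC : CharZero (Y.presheaf.stalk (g x)) := by
    rw [hx]
    infer_instance
  let R : Type u := Y.presheaf.stalk (g x)
  let S : Type u := X.presheaf.stalk x
  letI : Field R := hF.toField
  haveI : CharZero R := hC
  haveI : PerfectField R := PerfectField.ofCharZero
  letI : Algebra R S := (g.stalkMap x).hom.toAlgebra
  haveI : Algebra.EssFiniteType R S := LocallyOfFiniteType.stalkMap g x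
  haveI : IsRegularLocalRing S := hreg
  exact formallySmooth_of_isRegularLocalRing_of_perfectField R S

/-- The same for a closed subscheme (or any scheme over `X`) `ι : V → X`: a point `z ∈ V` with
regular local ring lying over the generic point of `Y` is in the smooth locus of `ι ≫ g`.
[cite: StacksProject, Tag 00TV] -/
theorem mem_smoothLocus_comp_of_isRegularLocalRing [IsIntegral Y] [CharZero Y.functionField]
    (g : X ⟶ Y) {V : Scheme.{u}} (ι : V ⟶ X) [LocallyOfFinitePresentation (ι ≫ g)] {z : V}
    (hz : g (ι z) = genericPoint Y) (hreg : IsRegularLocalRing (V.presheaf.stalk z)) :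
    z ∈ (ι ≫ g).smoothLocus :=
  mem_smoothLocus_of_isRegularLocalRing_of_apply_eq_genericPoint (ι ≫ g)
    (by rw [Scheme.Hom.comp_apply]; exact hz) hreg

/-! ## One open of the base over which finitely many regular subschemes are smooth -/

/-- **Generic smoothness for finitely many regular subschemes at once.** Let `Y` be integral
with function field of characteristic zero, `g : X → Y`, and `ι_t : V_t → X` (`t ∈ τ`, finite)
morphisms with `ι_t ≫ g` universally closed and locally of finite presentation, such that every
point of `V_t` over the generic point of `Y` has regular local ring. Then there is an open
`O ∋ η` of `Y` over which every `ι_t ≫ g` is smooth: each bad locus `(ι_t ≫ g)(V_t ∖ sm)` is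
closed and misses `η`; remove their finite union. [cite: Hartshorne1977, III Cor. 10.7]
[cite: StacksProject, Tag 01V9] -/
theorem exists_mem_and_forall_smooth_morphismRestrict [IsIntegral Y] [CharZero Y.functionField]
    (g : X ⟶ Y) {τ : Type*} [Finite τ] {V : τ → Scheme.{u}} (ι : ∀ t, V t ⟶ X)
    [∀ t, LocallyOfFinitePresentation (ι t ≫ g)] [∀ t, UniversallyClosed (ι t ≫ g)]
    (hreg : ∀ t (z : V t), g (ι t z) = genericPoint Y → IsRegularLocalRing ((V t).presheaf.stalk z)) :
    ∃ O : Y.Opens, genericPoint Y ∈ O ∧ ∀ t, Smooth ((ι t ≫ g) ∣_ O) := by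
  -- the bad loci
  let B : τ → Set Y := fun t => (ι t ≫ g) '' ((ι t ≫ g).smoothLocus : Set (V t))ᶜ
  have hBc : ∀ t, IsClosed (B t) := fun t =>
    (ι t ≫ g).isClosedMap _ (ι t ≫ g).smoothLocus.isOpen.isClosed_compl
  have hBη : ∀ t, genericPoint Y ∉ B t := by
    rintro t ⟨z, hz, hzη⟩
    refine hz (mem_smoothLocus_comp_of_isRegularLocalRing g (ι t) ?_ (hreg t z ?_))
    all_goals rw [← Scheme.Hom.comp_apply]; exact hzη
  have hU : IsClosed (⋃ t, B t) := isClosed_iUnion_of_finite hBc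
  refine ⟨⟨(⋃ t, B t)ᶜ, hU.isOpen_compl⟩, ?_, fun t => ?_⟩
  · simp only [Opens.mem_mk, Set.mem_compl_iff, Set.mem_iUnion, not_exists]
    exact hBη
  · refine smooth_morphismRestrict_of_preimage_le_smoothLocus (ι t ≫ g) _ fun z hz => ?_
    by_contra hzs
    exact hz (Set.mem_iUnion.2 ⟨t, z, hzs, rfl⟩)

/-! ## The strata of a simple normal crossings boundary -/

/-- The local rings of a stratum `V(∑_{K∈T} K)` of an snc boundary are regular.
[cite: Matsumura1987, Thm. 14.2] -/
theorem HasSNC.isRegularLocalRing_stalk_finsetSup [IsLocallyNoetherian X]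
    {E : List X.IdealSheafData} (hE : HasSNC E) (T : Finset X.IdealSheafData)
    (hT : ∀ K ∈ T, K ∈ E) (z : (T.sup id).subscheme) :
    IsRegularLocalRing ((T.sup id).subscheme.presheaf.stalk z) :=
  hE.isRegular_subscheme_finsetSup T hT z

/-- **Generic smoothness of all snc strata.** Let `Y` be integral with function field of
characteristic zero, `X` locally Noetherian, `g : X → Y` universally closed and locally of finite
presentation with the same for every stratum, and `E` an snc boundary on `X`. Then there is an
open `O ∋ η` of `Y` over which `g` and every stratum `V(∑_{K∈T} K) → Y` (`T` a finite set of
members of `E`) are smooth. [cite: Hartshorne1977, III Cor. 10.7]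
[cite: BierstoneGrigorievMilmanWlodarczyk2011, Def. 3.1.1] -/
theorem HasSNC.exists_forall_smooth_strata [IsIntegral Y] [CharZero Y.functionField]
    [IsLocallyNoetherian X] (g : X ⟶ Y) [LocallyOfFinitePresentation g] [UniversallyClosed g]
    {E : List X.IdealSheafData} (hE : HasSNC E)
    [∀ T : Finset X.IdealSheafData, LocallyOfFinitePresentation ((T.sup id).subschemeι ≫ g)] :
    ∃ O : Y.Opens, genericPoint Y ∈ O ∧ Smooth (g ∣_ O) ∧
      ∀ T : Finset X.IdealSheafData, (∀ K ∈ T, K ∈ E) →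
        Smooth (((T.sup id).subschemeι ≫ g) ∣_ O) := by
  classical
  -- index the strata by the finite sets of members of `E`, plus `X` itself
  let τ : Type u := Option {T : Finset X.IdealSheafData // ∀ K ∈ T, K ∈ E}
  haveI : Finite {T : Finset X.IdealSheafData // ∀ K ∈ T, K ∈ E} := by
    have hsub : ∀ T : {T : Finset X.IdealSheafData // ∀ K ∈ T, K ∈ E}, T.1 ⊆ E.toFinset :=
      fun T K hK => List.mem_toFinset.2 (T.2 K hK)
    refine Finite.of_injective (fun T => (⟨T.1, Finset.mem_powerset.2 (hsub T)⟩ :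
      E.toFinset.powerset)) fun T T' h => Subtype.ext (by simpa using h)
  haveI : Finite τ := inferInstance
  let V : τ → Scheme.{u} := fun t => t.elim X fun T => (T.1.sup id).subscheme
  let ι : ∀ t, V t ⟶ X := fun t => match t with
    | none => 𝟙 X
    | some T => (T.1.sup id).subschemeι
  haveI : ∀ t, LocallyOfFinitePresentation (ι t ≫ g) := fun t => match t with
    | none => by change LocallyOfFinitePresentation (𝟙 X ≫ g); rw [Category.id_comp]; infer_instance
    | some T => inferInstanceAs (LocallyOfFinitePresentation ((T.1.sup id).subschemeι ≫ g))
  haveI : ∀ t, UniversallyClosed (ι t ≫ g) := fun t => match t with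
    | none => by change UniversallyClosed (𝟙 X ≫ g); rw [Category.id_comp]; infer_instance
    | some T => inferInstanceAs (UniversallyClosed ((T.1.sup id).subschemeι ≫ g))
  have hreg : ∀ t (z : V t), g (ι t z) = genericPoint Y →
      IsRegularLocalRing ((V t).presheaf.stalk z) := fun t => match t with
    | none => fun z _ => (hE z).1
    | some T => fun z _ => hE.isRegularLocalRing_stalk_finsetSup T.1 T.2 z
  obtain ⟨O, hηO, hO⟩ := exists_mem_and_forall_smooth_morphismRestrict g ι hreg
  refine ⟨O, hηO, ?_, fun T hT => hO (some ⟨T, hT⟩)⟩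
  have h := hO none
  change Smooth ((𝟙 X ≫ g) ∣_ O) at h
  rwa [Category.id_comp] at h

end Literature.AlgebraicGeometry.Resolution

end
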